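import Summits.BirchSwinnertonDyer.BirchSwinnertonDyer.Theorems.ManinLocalTwoThreeManinPrimeToAdditiveFiveLeLedgerFourPrintsNoDD
import HarnessLib

/-!
# Route `ManinLocalTwoThree`, residual crux C5 `ManinPrimeToAdditiveFiveLe` (stmt-BirchSwinnertonDyer-22969), line `upper_anchor`
# (skeleton v17): **modulo the four prints, C5 IS route `TwistFamilyManinDescent`'s declared residual R** —
# `C5 ⟸ {F″, EdK, EdG, MazurJ} ∧ R` and `R ⟸ C5`, with NO orientation law (K15a, I9, C2), NO Ihara³, NO Cremona table,
# NO `LargePrimeReducibleJ` on the path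

Lead seat bsd-line-ml23-c5-p1 (gen 8). THEOREMS ONLY (no definition, no named fact, no `sorry`).

The registered skeleton v16 (sha16 6c8fe72cdf2e0886) composes C5 BY NAME from the four cite-only prints {Kato F″, Edixhoven Thm. 3
(Kodaira half EdK, ordinarity half EdG), Mazur's `j`-list MazurJ} and the SEVEN LEAVES of route `TwistFamilyManinDescent`
(`maninPrimeToAdditiveFiveLe_of_fourPrints_of_sevenLeaves`, p640646). Three of those leaves — K15a `SupersingularStrongIsUnstarred` (27072),
I9 `OrdinaryCornerOptimalSerreTateDeep` (27660), C2 `EisensteinOrdinaryStrongIsTop` (26929) — are ORIENTATION laws which C5 does not imply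
(lead gen 6/7 classification, p632301 / p638426): they entered only through the ROW DISPATCH of the reducible residual at `p ∈ {5, 7}`
(starred supersingular rows emptied by K15a, the ordinary corner read on Serre–Tate-deep optimal curves by I9) and through the lattice
TRICHOTOMY at `p = 13` (middle configuration excluded by C2). None of them is needed for C5:

* `not_dvd_c_large_of_not_typeGOrd_unstarred` — Edixhoven's two printed forms at `p > 7` OFF the (G)-ordinary unstarred rows, with NO
  reducibility, NO C1/C2 and NO `p = 13` core (the branch of pub/bsd-wall's `not_dvd_c_large` that never touches the trichotomy);
* `reducibleTwistMinimal_of_threePrints_of_residual` — the `W[p]`-reducible twist-minimal residual of C5 (hypothesis `hRED` of the width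
  seat's Kato reduction p611587, VERBATIM) ⟸ {EdK, EdG, MazurJ} ∧ R: at `p ∈ {5, 7, 13}` the item R
  `TwistFamilyManinDescent.EisensteinAdditiveManinResidual` (stmt-BirchSwinnertonDyer-25138) BY NAME — its twist-additivity clause is the
  line's odd twist-minimality (`quadraticTwist_pStar_additive_of_twistMinimal`), its level is the conductor; at `p ≥ 11`, `p ≠ 13` Mazur's
  `j`-list empties the (G)-ordinary unstarred rows (`not_typeGOrd_of_not_hasIrreducibleModPGaloisRep_of_eleven_le`, and at `37`
  `four_lt_padicValInt_of_not_hasIrreducibleModPGaloisRep_thirtySeven`) so the previous theorem applies;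
* **`maninPrimeToAdditiveFiveLe_of_fourPrints_of_residual : F″ → EdK → EdG → MazurJ → R → C5 BY NAME`** — the Kato reduction
  `maninLocalTwoThree_maninPrimeToAdditiveFiveLe_of_kato57_of_cores` (p611587) fed with `coreKP_of_kato` (irreducible locus ⟸ modularity ∧ F″,
  pub/bsd-wall's `TeichmullerTwistDescent.not_dvd_c_of_kato`) and the previous theorem;
* **`eisensteinAdditiveManinResidual_of_maninPrimeToAdditiveFiveLe : C5 → R`** (R is a literal special case: `p ∈ {5, 7, 13, 163} ⇒ 5 ≤ p`);
* **`maninPrimeToAdditiveFiveLe_iff_residual_of_fourPrints`** — granted the four prints, `C5 ↔ R`.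

So the line `upper_anchor`, as a reduction, ends here: C5's open content modulo {F″, EdK, EdG, MazurJ} is EXACTLY the registered item R
(stmt-25138), whose own decomposition (seven leaves, orientation laws included) is route `TwistFamilyManinDescent`'s business, not C5's.
Compared with TFMD's closed `Assembly` (C5 ⟸ `KatoIharaCremonaFacts` ∧ `LargePrimeReducibleJ` ∧ R, `…OfTwistFamilyLedger.lean`): Ihara³,
Cremona's table `N ≤ 5·10⁵` and the open support item `LargePrimeReducibleJ` (25139) are replaced by Edixhoven's printed Thm. 3 and Mazur's
printed `j`-list; the `163`-corner clause of R is idle here (at `163` a `W[163]`-reducible curve is CM, hence never (G)-ordinary, and EdG applies).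

HONEST STATUS (`--supports 22969`, helper): the four prints are cite-only `def … : Prop` (F″ referee-flagged), R is an OPEN item
([difficulty: open-problem] — Manin's conjecture at the Eisenstein additive primes 5, 7, 13). Nothing here proves R, C5, any leaf, Manin's
conjecture or BSD; the gain is that three beyond-print orientation laws leave C5's path of record.

References: [Kato2004Asterisque] (8.1.3), Thm. 9.7; [EdixhovenManin1991] Thm. 3, §4; [Mazur1978] Thm. 1; [Stevens1989] Lemmas (5.2), (5.4);
route TwistFamilyManinDescent (bsd-idea-3) item 25138.
-/

set_option autoImplicit false
-- the Theorems namespace of this sub repeats the summit name by design (D-0017 nested layout)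
set_option linter.dupNamespace false

noncomputable section

open scoped Classical NumberField

open WeierstrassCurve IsDedekindDomain Rat.HeightOneSpectrum NumberField
  Literature.NumberTheory.EllipticCurves Literature.NumberTheory.EllipticCurves.ModularForms
  Literature.NumberTheory.EllipticCurves.Rank1Residual
  Summit.BirchSwinnertonDyer.Rank1Residual Summit.BirchSwinnertonDyer.Rank1Residual.Additive
  Summit.BirchSwinnertonDyer.Rank1Residual.ManinAdditive
  Summit.BirchSwinnertonDyer.BirchSwinnertonDyer.Theses.TwistFamilyManinDescent

namespace Summit.BirchSwinnertonDyer.BirchSwinnertonDyer.Theorems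

/-! ### §1 Edixhoven at `p > 7` off the (G)-ordinary unstarred rows — no trichotomy, no reducibility -/

/-- **Edixhoven's two printed forms at `p > 7`, OFF the (G)-ordinary unstarred rows.** For `W/ℚ` globally minimal, `D` a datum at the
conductor level with `Λ_W ⊆ c·Λ_f`, `p > 7` prime with `p² ∣ N` and NOT ((G)-ordinary ∧ `ord_p Δ_min ≤ 4`): `p ∤ c(D)`. Split:
`ord_p Δ_min ≤ 4` ⟹ not (G)-ordinary ⟹ EdG (its hypothesis is `¬ TypeGOrd` verbatim); `ord_p Δ_min > 4` ⟹ Kodaira symbol not II/III/IV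
(`kodairaSymbolAt_placeOf_II_or_III_or_IV_iff_of_addv`) ⟹ EdK. The branch of pub/bsd-wall's `not_dvd_c_large` that never reaches the
`13`-core; conditional on the two cite-only prints. [cite: EdixhovenManin1991, Thm. 3] -/
theorem not_dvd_c_large_of_not_typeGOrd_unstarred
    (hEdK : edixhoven_not_dvd_maninConstant_of_kodairaSymbol_ne)
    (hEdG : edixhoven_not_dvd_maninConstant_of_not_potentiallyGoodOrdinary)
    (W : WeierstrassCurve ℚ) [W.IsElliptic] [W.IsGloballyMinimal] (p : ℕ) [Fact p.Prime]
    [NeZero (W.conductorNorm ℤ)] (D : ModularParametrizationData W (W.conductorNorm ℤ))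
    (hp7 : 7 < p) (hno : ¬ (TypeGOrd W p ∧ padicValInt p W.minimalDiscriminantInt ≤ 4))
    (hsq : p ^ 2 ∣ W.conductorNorm ℤ)
    (hopt : ∀ z ∈ D.L.lattice, ∃ w ∈ periodLattice D.f, z = D.c * w) :
    ¬ (p : ℤ) ∣ D.maninConstant := by
  have hpP : p.Prime := Fact.out
  have hp5 : 5 ≤ p := by omega
  have hadd : Rank1Residual.Addv W p := not_good_and_not_mult_of_sq_dvd_conductorNorm W hsq
  by_cases hlow : padicValInt p W.minimalDiscriminantInt ≤ 4
  · -- unstarred: not (G)-ordinary by `hno`, Edixhoven's ordinarity form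
    exact hEdG W D hopt p hpP hp7 (fun hGo ↦ hno ⟨hGo, hlow⟩)
  · -- starred: Edixhoven's Kodaira form
    have hnot : ¬ (W.kodairaSymbolAt (placeOf p) = .II ∨ W.kodairaSymbolAt (placeOf p) = .III ∨
        W.kodairaSymbolAt (placeOf p) = .IV) :=
      fun h ↦ hlow ((kodairaSymbolAt_placeOf_II_or_III_or_IV_iff_of_addv W p hp5 hadd).mp h)
    exact hEdK W D hopt p hpP hp7 (fun h ↦ hnot (Or.inl h)) (fun h ↦ hnot (Or.inr (Or.inl h)))
      (fun h ↦ hnot (Or.inr (Or.inr h)))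

/-! ### §2 The reducible twist-minimal residual of C5 from R by name -/

/-- **The `W[p]`-reducible twist-minimal residual of C5 (hypothesis `hRED` of p611587, VERBATIM) ⟸ THREE prints {EdK, EdG, MazurJ} ∧ R
(`TwistFamilyManinDescent.EisensteinAdditiveManinResidual`, stmt-BirchSwinnertonDyer-25138, BY NAME)** — NO orientation law, NO trichotomy:
`p ∈ {5, 7, 13}` by R itself (its twist-additivity clause from odd twist-minimality, `quadraticTwist_pStar_additive_of_twistMinimal`; its level the
conductor), `p ≥ 11`, `p ≠ 13` by `not_dvd_c_large_of_not_typeGOrd_unstarred` with Mazur's `j`-list emptying the (G)-ordinary unstarred rows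
(`37`: starred; other `p`: potentially supersingular). Conditional result on an OPEN item and cite-only prints.
[cite: EdixhovenManin1991, Thm. 3 and §4] [cite: Mazur1978, Thm. 1] -/
theorem reducibleTwistMinimal_of_threePrints_of_residual
    (hEdK : edixhoven_not_dvd_maninConstant_of_kodairaSymbol_ne)
    (hEdG : edixhoven_not_dvd_maninConstant_of_not_potentiallyGoodOrdinary)
    (hJ : mazur_j_mem_of_not_hasIrreducibleModPGaloisRep_of_eleven_le)
    (hR : EisensteinAdditiveManinResidual) :
    mazur_not_dvd_maninConstant_of_odd → abbesUllmo_not_dvd_maninConstant_of_not_dvd_level →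
    cesnavicius_not_two_dvd_maninConstant_of_two_dvd_level → exists_isNewformOf →
    ∀ (W : WeierstrassCurve ℚ) [W.IsElliptic] [W.IsGloballyMinimal] [NeZero (W.conductorNorm ℤ)]
      (D : ModularParametrizationData W (W.conductorNorm ℤ)),
      IsLatticeOptimal D → ∀ p : ℕ, p.Prime → 5 ≤ p → p ^ 2 ∣ W.conductorNorm ℤ →
      ¬ (∃ (W' : WeierstrassCurve ℚ) (q : ℕ), W'.IsElliptic ∧ W'.IsGloballyMinimal ∧ q.Prime ∧
          q ≠ 2 ∧ q ^ 2 ∣ W.conductorNorm ℤ ∧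
          IsIsogenous W (W'.quadraticTwist (((-1 : ℤ) ^ (q / 2) * q : ℤ) : ℚ)) ∧
          ¬ q ^ 2 ∣ W'.conductorNorm ℤ) →
      ¬ (∃ (W' : WeierstrassCurve ℚ) (d : ℤ), W'.IsElliptic ∧ W'.IsGloballyMinimal ∧
          (d = -1 ∨ d = 2 ∨ d = -2) ∧ 2 ^ 2 ∣ W.conductorNorm ℤ ∧
          IsIsogenous W (W'.quadraticTwist (d : ℚ)) ∧ ¬ 2 ^ 2 ∣ W'.conductorNorm ℤ) →
      ¬ W.HasIrreducibleModPGaloisRep p →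
      ¬ (p : ℤ) ∣ D.maninConstant := by
  intro hM hAU hC hnf W _ _ _ D hD p hp h5 hpN hodd _hdy hred
  haveI hpF : Fact p.Prime := ⟨hp⟩
  have hp2 : p ≠ 2 := by omega
  by_cases h5713 : p = 5 ∨ p = 7 ∨ p = 13
  · -- `p ∈ {5, 7, 13}`: `W ⊗ p*` is additive by odd twist-minimality; R by name
    have htw := quadraticTwist_pStar_additive_of_twistMinimal W hp hp2 hpN hodd
    have hrow : p = 5 ∨ p = 7 ∨ p = 13 ∨ (p = 163 ∧ 2 ^ 6 ∣ W.conductorNorm ℤ) := by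
      rcases h5713 with h | h | h
      · exact Or.inl h
      · exact Or.inr (Or.inl h)
      · exact Or.inr (Or.inr (Or.inl h))
    exact hR hM hAU hC hnf W D p hp hrow hpN hred htw hD
  · -- `p ≥ 11`, `p ≠ 13`: Mazur's `j`-list empties the (G)-ordinary unstarred rows; Edixhoven's two forms
    have hne5 : p ≠ 5 := fun h ↦ h5713 (Or.inl h)
    have hne7 : p ≠ 7 := fun h ↦ h5713 (Or.inr (Or.inl h))
    have hp13 : p ≠ 13 := fun h ↦ h5713 (Or.inr (Or.inr h))
    have hp6 : p ≠ 6 := by rintro rfl; norm_num at hp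
    have hp8 : p ≠ 8 := by rintro rfl; norm_num at hp
    have hp9 : p ≠ 9 := by rintro rfl; norm_num at hp
    have hp10 : p ≠ 10 := by rintro rfl; norm_num at hp
    have h7 : 7 < p := by omega
    have h11 : 11 ≤ p := by omega
    have hadd : Addv W p := not_good_and_not_mult_of_sq_dvd_conductorNorm W hpN
    refine not_dvd_c_large_of_not_typeGOrd_unstarred hEdK hEdG W p D h7 ?_ hpN hD
    rintro ⟨hG, hv4⟩
    by_cases hp37 : p = 37
    · subst hp37
      have h4 := four_lt_padicValInt_of_not_hasIrreducibleModPGaloisRep_thirtySeven W hJ hadd hred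
      omega
    · exact not_typeGOrd_of_not_hasIrreducibleModPGaloisRep_of_eleven_le W p hJ h11 hp13 hp37 hadd hred hG

/-! ### §3 C5 ⟺ R modulo the four prints -/

/-- **Crux C5 `ManinLocalTwoThree.ManinPrimeToAdditiveFiveLe` BY NAME ⟸ FOUR cite-only prints {Kato F″, EdK, EdG, MazurJ} ∧ R
(`TwistFamilyManinDescent.EisensteinAdditiveManinResidual`, stmt-BirchSwinnertonDyer-25138)** — the width seat's Kato reduction p611587 fed with the
`W[p]`-irreducible locus from modularity ∧ F″ alone (`coreKP_of_kato`) and the reducible residual of `reducibleTwistMinimal_of_threePrints_of_residual`.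
No orientation law (K15a, I9, C2), no Ihara³, no Cremona table, no `LargePrimeReducibleJ`, no Dokchitser–Dokchitser. Conditional result
(`--supports`, helper). [cite: Kato2004Asterisque, (8.1.3) and Thm. 9.7] [cite: EdixhovenManin1991, Thm. 3] [cite: Mazur1978, Thm. 1] -/
theorem maninPrimeToAdditiveFiveLe_of_fourPrints_of_residual
    (hK57 : kato_neron_isIntegral_twistedSymbolSum_of_additive_five_le)
    (hEdK : edixhoven_not_dvd_maninConstant_of_kodairaSymbol_ne)
    (hEdG : edixhoven_not_dvd_maninConstant_of_not_potentiallyGoodOrdinary)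
    (hJ : mazur_j_mem_of_not_hasIrreducibleModPGaloisRep_of_eleven_le)
    (hR : EisensteinAdditiveManinResidual) :
    Summit.BirchSwinnertonDyer.BirchSwinnertonDyer.Theses.ManinLocalTwoThree.ManinPrimeToAdditiveFiveLe := by
  intro hM hAU hC hnf
  exact maninLocalTwoThree_maninPrimeToAdditiveFiveLe_of_kato57_of_cores hK57 (coreKP_of_kato hnf hK57)
    (reducibleTwistMinimal_of_threePrints_of_residual hEdK hEdG hJ hR) hM hAU hC hnf

/-- **R ⟸ C5** (unconditionally): route `TwistFamilyManinDescent`'s declared residual `EisensteinAdditiveManinResidual` (stmt-25138) is a literal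
special case of C5 — same four hypothesis facts, same datum shape at an arbitrary level `N` with `p² ∣ N` and `Λ_W ⊆ c·Λ_f`; its primes
`p ∈ {5, 7, 13, 163}` are `≥ 5`; its reducibility and twist-additivity clauses are simply dropped. [cite: EdixhovenManin1991, Thm. 3] -/
theorem eisensteinAdditiveManinResidual_of_maninPrimeToAdditiveFiveLe
    (h : Summit.BirchSwinnertonDyer.BirchSwinnertonDyer.Theses.ManinLocalTwoThree.ManinPrimeToAdditiveFiveLe) :
    EisensteinAdditiveManinResidual := by
  intro hM hAU hC hnf W _ _ N _ D p hp hrow hpN _hred _htw hlat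
  have h5 : 5 ≤ p := by
    rcases hrow with rfl | rfl | rfl | ⟨rfl, -⟩ <;> norm_num
  exact h hM hAU hC hnf W D hlat p hp h5 hpN

/-- **Granted the four prints {F″, EdK, EdG, MazurJ}, C5 ⟺ R**: the residual crux C5 of route `ManinLocalTwoThree` (stmt-22969) and the
declared residual R of route `TwistFamilyManinDescent` (stmt-25138) are EQUIVALENT modulo Kato's F″, Edixhoven's Thm. 3 (both halves) and
Mazur's `j`-list — the line `upper_anchor` as a reduction is complete: the open content of C5 on its path of record is exactly the item R.
Conditional result (`--supports`, helper); neither side is proved. [cite: Kato2004Asterisque, Thm. 9.7] [cite: EdixhovenManin1991, Thm. 3]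
[cite: Mazur1978, Thm. 1] -/
theorem maninPrimeToAdditiveFiveLe_iff_residual_of_fourPrints
    (hK57 : kato_neron_isIntegral_twistedSymbolSum_of_additive_five_le)
    (hEdK : edixhoven_not_dvd_maninConstant_of_kodairaSymbol_ne)
    (hEdG : edixhoven_not_dvd_maninConstant_of_not_potentiallyGoodOrdinary)
    (hJ : mazur_j_mem_of_not_hasIrreducibleModPGaloisRep_of_eleven_le) :
    Summit.BirchSwinnertonDyer.BirchSwinnertonDyer.Theses.ManinLocalTwoThree.ManinPrimeToAdditiveFiveLe ↔
      EisensteinAdditiveManinResidual :=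
  ⟨eisensteinAdditiveManinResidual_of_maninPrimeToAdditiveFiveLe,
    maninPrimeToAdditiveFiveLe_of_fourPrints_of_residual hK57 hEdK hEdG hJ⟩

end Summit.BirchSwinnertonDyer.BirchSwinnertonDyer.Theorems

end
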